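import Summits.BirchSwinnertonDyer.BirchSwinnertonDyer.Theorems.CyclotomicUntwistNineIntegersStructure
import HarnessLib

/-!
# The ring `𝓞 = integralClosure ℤ₃ ℚ₃(ζ₉)` of the LOCAL currency of `DescendedFrobeniusMatrix`, IV: the Galois group
# preserves residues, the UNIT CRITERION, `𝓞` is LOCAL with maximal ideal `(1 − ζ₉)`, and `𝓞` is a DISCRETE
# VALUATION RING — the "valuation ring of `L = ℚ₃(ζ₉)`" of the p623342 docstring as a theorem

Cell `pub/bsd-wall` (D-0145 line `route-BirchSwinnertonDyer-CyclotomicUntwist`), seat `bsd-line-cycu-p4` (gen 7),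
helper toward K1 `PSRankOneLowerHalfAtThree` (stmt-BirchSwinnertonDyer-21580) / K2 (21581); line `dfrob`, stub S2 /
item C2 (stmt-27549) currency. Sequel of `CyclotomicUntwistNineIntegers{,ResidueMap,Structure}.lean`. THEOREMS ONLY
(no definition, no `instance`, no named fact, no `sorry`); BSD is not proved by this file and no crux is.

## What and why

`NineGoodModel` (Literature `DescendedFrobeniusMatrix`, p623342) is an equation over `𝓞 = ONine` with unit
discriminant; its docstring calls `𝓞` "the valuation ring" of `L = ℚ₃(ζ₉)` and its maximal ideal "the kernel of any
reduction map". With this file those are kernel facts, so that Mathlib's reduction theory of Weierstrass equations over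
a discrete valuation ring (`WeierstrassCurve.IsIntegral / IsMinimal / reduction`) applies verbatim to `𝓞`:

* §11 Galois action: every `σ : K ≃ₐ[ℚ₃] K` sends `ζ₉ ↦ ζ₉ᵏ`, preserves `𝓞` and the ideal `(1 − ζ₉)`
  (`σ(1 − ζ₉) = (1 − ζ₉)(1 + ζ₉ + ⋯ + ζ₉ᵏ⁻¹)`), hence preserves residue digits: **`residueMap_algEquiv`**
  (`ρ (σ x) = ρ x`);
* §12 **unit criterion** `isUnit_iff_residueMap_ne_zero`: `x ∈ 𝓞` is a unit iff its residue is `≠ 0` — the norm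
  `N(x) = ∏_σ σx` (`Algebra.norm_eq_prod_automorphisms`, `K/ℚ₃` Galois) lies in `ℤ₃` (`Algebra.isIntegral_norm`),
  has residue `(ρ x)⁶ ≠ 0`, so is a `3`-adic unit, and `x⁻¹ = N(x)⁻¹·∏_{σ ≠ 1} σx ∈ 𝓞`;
* §13 **`isLocalRing : IsLocalRing ONine`**, **`maximalIdeal_eq`** (`= 𝓞·(1 − ζ₉) = ker ρ`), `not_isField`,
  `isNoetherianRing` (`IsIntegralClosure.isNoetherianRing`), and **`isDiscreteValuationRing :
  IsDiscreteValuationRing ONine`** (Noetherian local domain with principal non-zero maximal ideal; Mathlib's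
  `IsDiscreteValuationRing.TFAE`). Uniformizer `1 − ζ₉`, residue field `𝔽₃` (`nonempty_quotient_equiv_zmod`),
  `e = 6` (`three_eq_neg_pow_six_mul_thetaInv`), `f = 1`, `[K : ℚ₃] = 6` (`finrank_eq_six`), `𝓞 = ℤ₃[ζ₉]`
  (`integralClosure_eq_adjoin`): the standard local picture of `ℚ₃(ζ₉)`, none of which Mathlib has for a `p`-adic
  cyclotomic field. Stated as theorems (not instances), to be introduced with `haveI` by consumers.

References: J.-P. Serre, *Local Fields*, GTM 67, I §6–§7, II §3 [SerreLocalFields1979]; L. C. Washington, *Introduction to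
Cyclotomic Fields*, GTM 83, Lemma 1.4, Prop. 2.8 [Washington1997]; F. Q. Gouvêa, *p-adic Numbers*, §5 [Gouvea1993PadicNumbers].
-/

noncomputable section

open scoped Polynomial

open Polynomial IsCyclotomicExtension Literature.NumberTheory.EllipticCurves.DescendedFrobenius
  Summit.BirchSwinnertonDyer.BirchSwinnertonDyer.Theorems

-- single-conjunct summit: `Summit.BirchSwinnertonDyer.BirchSwinnertonDyer.…` repeats the name by design
set_option linter.dupNamespace false
set_option autoImplicit false

namespace Summit.BirchSwinnertonDyer.BirchSwinnertonDyer.Theorems.NineIntegers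

/-! ### §11 The Galois group of `ℚ₃(ζ₉)/ℚ₃` preserves `𝓞` and the ideal `(1 − ζ₉)` -/

/-- Every `ℚ₃`-automorphism sends `ζ₉` to a power of `ζ₉`. [folklore] -/
theorem exists_algEquiv_zeta_eq_pow (σ : KNine ≃ₐ[ℚ_[3]] KNine) :
    ∃ k : ℕ, σ (zeta 9 ℚ_[3] KNine) = zeta 9 ℚ_[3] KNine ^ k := by
  have h9 : (σ (zeta 9 ℚ_[3] KNine)) ^ 9 = 1 := by rw [← map_pow, zeta_spec.pow_eq_one, map_one]
  obtain ⟨k, -, hk⟩ := zeta_spec.eq_pow_of_pow_eq_one h9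
  exact ⟨k, hk.symm⟩

/-- Automorphisms preserve `𝓞`. [folklore] -/
theorem algEquiv_mem (σ : KNine ≃ₐ[ℚ_[3]] KNine) {x : KNine} (hx : x ∈ ONine) : σ x ∈ ONine := by
  have h : IsIntegral ℤ_[3] x := hx
  exact h.map (σ.toAlgHom.restrictScalars ℤ_[3])

/-- Automorphisms preserve the ideal `(1 − ζ₉)`: `σ(1 − ζ₉) = (1 − ζ₉)·(1 + ζ₉ + ⋯ + ζ₉ᵏ⁻¹)`. [folklore] -/
theorem exists_algEquiv_one_sub_zeta (σ : KNine ≃ₐ[ℚ_[3]] KNine) :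
    ∃ y ∈ ONine, σ (1 - zeta 9 ℚ_[3] KNine) = (1 - zeta 9 ℚ_[3] KNine) * y := by
  obtain ⟨k, hk⟩ := exists_algEquiv_zeta_eq_pow σ
  refine ⟨∑ i ∈ Finset.range k, zeta 9 ℚ_[3] KNine ^ i, sum_mem fun i _ => pow_mem zeta_mem i, ?_⟩
  rw [map_sub, map_one, hk, mul_neg_geom_sum]

/-- **Automorphisms respect residue digits**: if `x − a ∈ (1 − ζ₉)𝓞` then `σ x − a ∈ (1 − ζ₉)𝓞`. [folklore] -/
theorem exists_algEquiv_sub_eq_mul (σ : KNine ≃ₐ[ℚ_[3]] KNine) {x y : KNine} {a : ℤ} (hy : y ∈ ONine)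
    (h : x - a = (1 - zeta 9 ℚ_[3] KNine) * y) :
    ∃ y' ∈ ONine, σ x - a = (1 - zeta 9 ℚ_[3] KNine) * y' := by
  obtain ⟨u, hu, hσ⟩ := exists_algEquiv_one_sub_zeta σ
  refine ⟨u * σ y, mul_mem hu (algEquiv_mem σ hy), ?_⟩
  have := congrArg σ h
  rw [map_sub, map_intCast, map_mul, hσ] at this
  rw [this, mul_assoc]

/-- Hence every reduction map is Galois-invariant: `ρ (σ x) = ρ x`. [folklore] -/
theorem residueMap_algEquiv (ρ : ONine →+* ZMod 3) (σ : KNine ≃ₐ[ℚ_[3]] KNine) (x : ONine) :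
    ρ ⟨σ x, algEquiv_mem σ x.2⟩ = ρ x := by
  obtain ⟨a, y, hy, h, hρ⟩ := exists_int_residueMap_eq ρ x
  obtain ⟨y', hy', h'⟩ := exists_algEquiv_sub_eq_mul σ hy h
  rw [hρ]
  exact residueMap_eq_of_sub_eq_mul ρ hy' h'

/-! ### §12 Units of `𝓞`: `x` is a unit iff its residue digit is non-zero -/

/-- A unit of `𝓞` has non-zero residue. [folklore] -/
theorem residueMap_ne_zero_of_isUnit (ρ : ONine →+* ZMod 3) {x : ONine} (hx : IsUnit x) : ρ x ≠ 0 :=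
  (hx.map ρ).ne_zero

/-- **Unit criterion**: an element of `𝓞` with non-zero residue digit is a unit of `𝓞`. Proof: its norm
`N = ∏_σ σ x ∈ ℤ₃` has residue `(ρ x)⁶ ≠ 0`, so it is a `3`-adic unit, and `x⁻¹ = N⁻¹ · ∏_{σ ≠ 1} σ x ∈ 𝓞`.
[folklore] -/
theorem isUnit_of_residueMap_ne_zero (ρ : ONine →+* ZMod 3) {x : ONine} (hx : ρ x ≠ 0) : IsUnit x := by
  classical
  haveI : FiniteDimensional ℚ_[3] KNine := IsCyclotomicExtension.finite {9} ℚ_[3] KNine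
  haveI : IsGalois ℚ_[3] KNine := IsCyclotomicExtension.isGalois {9} ℚ_[3] KNine
  -- the norm and its product formula
  have hprod := Algebra.norm_eq_prod_automorphisms ℚ_[3] (x : KNine)
  set n : ℚ_[3] := Algebra.norm ℚ_[3] (x : KNine) with hn
  -- `n ∈ ℤ₃`
  have hnint : IsIntegral ℤ_[3] n := Algebra.isIntegral_norm ℚ_[3] (x.2 : IsIntegral ℤ_[3] (x : KNine))
  obtain ⟨m, hm⟩ := IsIntegrallyClosed.isIntegral_iff.mp hnint
  have hmn : (m : ℚ_[3]) = n := hm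
  -- the cofactor `P = ∏_{σ ≠ 1} σ x ∈ 𝓞` with `x · P = N`
  set P : KNine := ∏ σ ∈ (Finset.univ : Finset (KNine ≃ₐ[ℚ_[3]] KNine)).erase 1, σ (x : KNine) with hP
  have hPmem : P ∈ ONine := prod_mem fun σ _ => algEquiv_mem σ x.2
  have hxP : (x : KNine) * P = algebraMap ℚ_[3] KNine n := by
    have key := Finset.mul_prod_erase (Finset.univ : Finset (KNine ≃ₐ[ℚ_[3]] KNine))
      (fun σ : KNine ≃ₐ[ℚ_[3]] KNine => σ (x : KNine)) (Finset.mem_univ 1)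
    rw [AlgEquiv.one_apply] at key
    rw [hprod, hP, key]
  -- the residue of `N` is `(ρ x) ^ 6 ≠ 0`
  have hNmem : algebraMap ℚ_[3] KNine n ∈ ONine := by rw [← hxP]; exact mul_mem x.2 hPmem
  have hρN : ρ ⟨algebraMap ℚ_[3] KNine n, hNmem⟩ ≠ 0 := by
    have e : (⟨algebraMap ℚ_[3] KNine n, hNmem⟩ : ONine) =
        ∏ σ : KNine ≃ₐ[ℚ_[3]] KNine, (⟨σ (x : KNine), algEquiv_mem σ x.2⟩ : ONine) := by
      apply Subtype.ext
      push_cast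
      exact hprod
    rw [e, map_prod]
    simp_rw [residueMap_algEquiv ρ]
    rw [Finset.prod_const]
    exact pow_ne_zero _ hx
  -- so `m` is a `3`-adic unit
  have hm1 : ‖m‖ = 1 := by
    refine le_antisymm m.2 (not_lt.mp fun hlt => hρN ?_)
    have h3 : (3 : ℤ_[3]) ∣ m := (PadicInt.norm_lt_one_iff_dvd m).mp hlt
    obtain ⟨m', hm'⟩ := h3
    have hn3 : n = 3 * ((m' : ℤ_[3]) : ℚ_[3]) := by
      rw [← hmn, hm', PadicInt.coe_mul]; rfl
    have e : (⟨algebraMap ℚ_[3] KNine n, hNmem⟩ : ONine) =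
        3 * ⟨algebraMap ℚ_[3] KNine ((m' : ℤ_[3]) : ℚ_[3]), algebraMap_mem_of_norm_le_one m'.2⟩ := by
      apply Subtype.ext
      push_cast
      rw [hn3, map_mul, map_ofNat]
    rw [e, map_mul, map_ofNat, show (3 : ZMod 3) = 0 from rfl, zero_mul]
  have hm0 : (m : ℚ_[3]) ≠ 0 := by
    intro h0
    have : ‖(m : ℚ_[3])‖ = 0 := by rw [h0, norm_zero]
    rw [← PadicInt.norm_def, hm1] at this
    exact one_ne_zero this
  have hminv : ‖(m : ℚ_[3])⁻¹‖ ≤ 1 := by rw [norm_inv, ← PadicInt.norm_def, hm1, inv_one]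
  -- the inverse of `x` in `𝓞`
  refine IsUnit.of_mul_eq_one (⟨P * algebraMap ℚ_[3] KNine ((m : ℚ_[3])⁻¹),
    mul_mem hPmem (algebraMap_mem_of_norm_le_one hminv)⟩ : ONine) (Subtype.ext ?_)
  show (x : KNine) * (P * algebraMap ℚ_[3] KNine ((m : ℚ_[3])⁻¹)) = 1
  rw [← mul_assoc, hxP, ← hmn, ← map_mul, mul_inv_cancel₀ hm0, map_one]

/-- **`x ∈ 𝓞` is a unit iff its residue is non-zero.** [folklore] -/
theorem isUnit_iff_residueMap_ne_zero (ρ : ONine →+* ZMod 3) (x : ONine) : IsUnit x ↔ ρ x ≠ 0 :=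
  ⟨residueMap_ne_zero_of_isUnit ρ, isUnit_of_residueMap_ne_zero ρ⟩

/-! ### §13 `𝓞` is a discrete valuation ring with uniformizer `1 − ζ₉` -/

/-- **`𝓞` is a local ring** (the non-units are the kernel of the reduction map). [folklore] -/
theorem isLocalRing : IsLocalRing ONine := by
  obtain ⟨ρ⟩ := nonempty_residueMap
  refine IsLocalRing.of_nonunits_add fun a b ha hb => ?_
  rw [mem_nonunits_iff, isUnit_iff_residueMap_ne_zero ρ, not_not] at ha hb ⊢
  rw [map_add, ha, hb, add_zero]

/-- **The maximal ideal of `𝓞` is `(1 − ζ₉)`** (= the kernel of the reduction map). [folklore] -/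
theorem maximalIdeal_eq :
    @IsLocalRing.maximalIdeal ONine _ isLocalRing =
      Ideal.span {(⟨1 - zeta 9 ℚ_[3] KNine, one_sub_zeta_mem⟩ : ONine)} := by
  obtain ⟨ρ⟩ := nonempty_residueMap
  letI := isLocalRing
  rw [← ker_residueMap_eq ρ]
  ext x
  rw [IsLocalRing.mem_maximalIdeal, mem_nonunits_iff, isUnit_iff_residueMap_ne_zero ρ, not_not, RingHom.mem_ker]

/-- `𝓞` is not a field (`1 − ζ₉` is a non-zero non-unit). [folklore] -/
theorem not_isField : ¬ IsField ONine := by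
  intro hF
  letI := hF.toField
  have hπ0 : (⟨1 - zeta 9 ℚ_[3] KNine, one_sub_zeta_mem⟩ : ONine) ≠ 0 := by
    intro h0
    have := congrArg Subtype.val h0
    exact GNine.one_sub_zeta_ne_zero zeta_spec this
  obtain ⟨y, hy⟩ := hF.mul_inv_cancel hπ0
  have := congrArg Subtype.val hy
  exact one_sub_zeta_mul_ne_one y.2 this

/-- `𝓞` is Noetherian (integral closure of `ℤ₃` in a finite separable extension). [folklore] -/
theorem isNoetherianRing : IsNoetherianRing ONine := by
  haveI : Module.Finite ℚ_[3] KNine := IsCyclotomicExtension.finite {9} ℚ_[3] KNine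
  exact IsIntegralClosure.isNoetherianRing ℤ_[3] ℚ_[3] KNine ONine

/-- **`𝓞 = integralClosure ℤ₃ ℚ₃(ζ₉)` is a discrete valuation ring** (Noetherian local domain whose maximal ideal
`(1 − ζ₉)` is principal and non-zero) — the "valuation ring of `L = ℚ₃(ζ₉)`" of the `DescendedFrobeniusMatrix`
docstring, as a theorem; uniformizer `1 − ζ₉`, residue field `𝔽₃` (`nonempty_quotient_equiv_zmod`), `e = 6`
(`three_eq_neg_pow_six_mul_thetaInv`). [folklore] -/
theorem isDiscreteValuationRing : IsDiscreteValuationRing ONine := by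
  haveI := isLocalRing
  haveI := isNoetherianRing
  have h := IsDiscreteValuationRing.TFAE ONine not_isField
  have hP : (IsLocalRing.maximalIdeal ONine).IsPrincipal :=
    ⟨⟨⟨1 - zeta 9 ℚ_[3] KNine, one_sub_zeta_mem⟩, by rw [maximalIdeal_eq]⟩⟩
  exact (h.out 0 4).mpr hP

end Summit.BirchSwinnertonDyer.BirchSwinnertonDyer.Theorems.NineIntegers

end
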